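import Summits.QuantumFields.YangMills.Theorems.UnitScaleTiltHalvingH59GammaDischargeFlatSplit
import HarnessLib

/-!
# Route `UnitScaleTilt`, crux K1 child «MinimiserStabilityRegPr» (stmt-QuantumFields-19200), registered stub `stub_halvingStep` (v10 `BirthV10`), line H, ROAD γ —
# ★★ «(γ-6) ρ5 SHAPE»: the three (1.59) discharge theorems of ✓`HalvingH59GammaDischargeFlatSplit` RE-LETTERED to the «ρ5» member prefix proposed by ★w3-20520 g8
# (01:26:52Z: per `L` two more letters `sx ρ₅ : ℕ`; per member THREE antecedents «`L^(sx+1) ∣ ρ + M + L + S → L^(sx+1) ∣ M′ → ρ₅ ≤ ρ →`» instead of the seven p. 98 guards) —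
# the seven guards are DERIVED per member (`Rx := ρ′ ∕ L^(sx+1)`, the lit floors folded into `ρ₅`, `sx := ⌈M₀⌉₊` so that `M₀ ≤ L^(sx+1)`).

Cell `ym3-torus` (HUMAN RULING D-0037: YM₃ on T³ is ladder rung R3 — NOT d = 4, NOT a mass gap, NOT the Clay problem), width seat `ym3-torus-px10` gen 3 (LEAD-H ★w5-19200 g6 WORD 28).
`--supports stmt-QuantumFields-19200 --as helper`; THEOREMS ONLY (0 `def`, 0 `sorry`); count-neutral; nothing here claims `SB9γAllL`, the stub, the crux or the gap.

WHAT IS PROVED (ns `…Theorems.HalvingH59GammaDischargeFlatRho5`):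
* ★★ `H59γ_flat_member5 (L) (hL)` — `∃ Bs sx ρ₅, 1 ≤ Bs ∧ ∀ F (F.L = L) n K (n < K) a M′ ρ′, L ≤ ρ′ → L^(sx+1) ∣ ρ′ → L^(sx+1) ∣ M′ → ρ₅ ≤ ρ′ → ∀ B₀ Bbd c, Bs ≤ B₀ → Bs ≤ Bbd → 0 ≤ c → c ≤ 1∕2 →
  ∀ V′ A′, … → <the composers' two lines over cubeLamBP′ … (K−n) (K−n)>` (the stripped composer shape).
* ★★ `H59TLγ5_holds_member (L) (hL)` — `∃ Bs sx ρ₅, 1 ≤ Bs ∧ ∀ M′ B₀ B₀'H B₂' BG BR cB9 Bbd, Bs ≤ B₀ → Bs ≤ Bbd → … → <✓p685244's displayed `H59TLγ` conjunct with the ONE line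
  «L ^ (sx + 1) ∣ ρ + M + L + S → L ^ (sx + 1) ∣ M′ → ρ₅ ≤ ρ →» inserted after `ρ′ = ρ + M + L + S →`>`.
* ★★ `H59DγL5_holds_member (L) (hL)` — the same for ✓p685747's displayed `H59DγL` conjunct, inserted line «2 ≤ K − n → L ^ (sx + 1) ∣ ρ + M + L + S → L ^ (sx + 1) ∣ M′ → ρ₅ ≤ ρ →».
USE (ρ5 packs ∕ K-final-γ): `obtain ⟨Bs, sx, ρ₅, hBs, H⟩ := H59TLγ5_holds_member L hL` once per `L` next to the socket letters (`B₀ Bbd ≥ Bs`); the conjunct is `H M′ B₀ … hcB9`;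
the door draws `ρ` with `L^(sx+1) ∣ ρ + M + L + S ∧ ρ₅ ≤ ρ` by ✓`HalvingRhoLinearBricks.exists_rho_163_pow_ge_mod` (`M = L^{aₑ}`, `S = R·M`, `aₑ ≥ sx + 1`), and `M′ := L^(sx+1)·q′`.

HONEST SCOPE.  Elementary ℕ∕ℝ bookkeeping over ✓p686552; the (1.59) analysis is lit's ([4] Thm 3.3 at `U = 1`, kernel-checked there); nothing of Prop. 3 ∕ Thm 4 ∕ `SB9γAllL` ∕ `hSupUρ4` ∕
the stub ∕ the crux is asserted; YM₃ on T³ = rung R3 — not d = 4, not Clay, no mass gap.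

References: T. Bałaban, CMP **99** (1985) 75–102 [Balaban1985RegularSpaces] ((1.58)–(1.59) p.86, (1.62) p.87, (1.31) p.82, p.98, Thm 4 p.88); CMP **99** (1985) 389–434
[Balaban1985BackgroundPropagators] (Thm 3.3 p.399, (3.47) p.398); CMP **96** (1984) 223–250 [Balaban1984PropagatorsII] ((2.3) p.224).
-/

set_option autoImplicit false

noncomputable section

open scoped BigOperators Matrix.Norms.L2Operator
open NormedSpace
open Complex (I)

namespace Summit.QuantumFields.YangMills.Theorems.HalvingH59GammaDischargeFlatRho5

open Literature.MathematicalPhysics.QuantumFieldTheory.Balaban1983to89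
open Literature.MathematicalPhysics.QuantumFieldTheory.Balaban1983to89.T3ContinuumYM3Torus
open Literature.MathematicalPhysics.QuantumFieldTheory.Balaban1983to89.T3PrintedRegularMinimiser (RegPr regFibrePr)
open B5Eq118OneStroke (iterBlockOf)
open B7Prop1Explicit (e)
open B7Prop1Explicit renaming Site → LSite
open B7Prop2Explicit (unitaryUnits avgIter)
open B7Prop1Local (InBox loK bondHiK)
open B7Eq92Concrete (mgauge)
open B8Ineq130 (tlo thi)
open B8Ineq132 (covDerivFwd InAk BondTouches)
open B8Eq119TwistedAxial (Restr129 InAx)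
open B8Eq131Cubes (tLo tHi)
open B8Eq131CubesAdmissible (cubeFam)
open B8CubeMemberZd (cubeLamS cubeLamB)
open B8Eq184Proof (cfgExp)
open B8Eq140Level (SideTouches)
open B8Eq146AExpansion (iEta)
open B8Eq138LandauZd (IsLandau138 IsLandau138W)
open B7Prop4GeneralLevels (linCovIter)
open B8Eq155JBound (Jcur wsup wsup_nonneg)
open B8ScaledSupNorm (bondNorm msup msup_nonneg)
open B9SupplySockB9P3ZdBeta (CrossB)
open B9SupplySockB9P3ZdGamma (cubeLamBP')
open B8Ineq159FlatCubeMemberPrinted (cubeLamBP Ineq159FlatCubeMemberPrinted)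
open B8Ineq159FlatCubeMemberTransplantL3 (ineq159FlatCubeMemberPrinted_holds_L3)
open B8Ineq159FlatCubeMemberSCGamma (sc4_cubeMember_of_ineq159Printed cubeLamBP_sub_splitIndex)
open B8Ineq159FlatOfScalarBdryBeta (flat159_clause_of_scalar_bdryβ)
open B10Eq27TorusAxialLog (pull pull_apply unitsField toUField gaugeActT)
open B15Eq112TorusCover (cover)
open HalvingH59GammaDischargeFlatSplit (H59γ_flat_member H59TLγP_holds_member H59DγLP_holds_member)
open HalvingHSupURhoWindowsRho3 (exists_topCall_constants_of_rhoWindow₃)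

/-! ## §1 The stripped composer shape, «ρ5» letters -/

/-- ★★ **«(γ-6) ρ5», COMPOSER SHAPE**: ✓`H59γ_flat_member` with the seven guards replaced by `L^(sx+1) ∣ ρ′`, `L^(sx+1) ∣ M′`, `ρ₅ ≤ ρ′` (`sx ρ₅` per `L`).
[cite: Balaban1985RegularSpaces, (1.58)-(1.59) p.86, (1.31) p.82, p.98; Balaban1985BackgroundPropagators, Thm 3.3 p.399] -/
theorem H59γ_flat_member5 (L : ℕ) (hL : 1 < L) :
    ∃ Bs : ℝ, ∃ sx ρ₅ : ℕ, 1 ≤ Bs ∧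
    ∀ (F : T3Family), F.L = L → ∀ (n K : ℕ), n < K →
    ∀ (a : LSite (F.P K).d) (M' ρ' : ℕ), L ≤ ρ' → L ^ (sx + 1) ∣ ρ' → L ^ (sx + 1) ∣ M' → ρ₅ ≤ ρ' →
    ∀ (B₀ Bbd c : ℝ), Bs ≤ B₀ → Bs ≤ Bbd → 0 ≤ c → c ≤ 1 / 2 →
    ∀ (V' : LSite (F.P K).d → Fin (F.P K).d → (Matrix (Fin 2) (Fin 2) ℂ)ˣ) (A' : LSite (F.P K).d → Fin (F.P K).d → (Matrix (Fin 2) (Fin 2) ℂ)),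
      IsLandau138W (F.P K).L (K - n) (((F.L : ℝ)⁻¹) ^ (K - n)) ((cubeFam false (F.P K).L a M' ρ' (K - n)) 0) (cubeLamS (F.P K).L a M' ρ' (K - n) (K - n))
        (1 : LSite (F.P K).d → Fin (F.P K).d → (Matrix (Fin 2) (Fin 2) ℂ)ˣ) V' →
      (∀ j, j ≤ K - n → ∀ y τ, SideTouches ((cubeFam false (F.P K).L a M' ρ' (K - n)) j) y τ →
        V' y τ = cfgExp (((F.L : ℝ)⁻¹) ^ (K - n)) A' y τ ∧ ‖A' y τ‖ ≤ c * (((F.P K).L : ℝ) ^ j * (((F.L : ℝ)⁻¹) ^ (K - n)))⁻¹) →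
      (∀ y τ, (∀ j, j ≤ K - n → ¬ SideTouches ((cubeFam false (F.P K).L a M' ρ' (K - n)) j) y τ) → A' y τ = 0) →
      msup (F.P K).L (K - n) (((F.L : ℝ)⁻¹) ^ (K - n)) (-(1 : ℝ)) (fun j (b : LSite (F.P K).d × Fin (F.P K).d) => SideTouches ((cubeFam false (F.P K).L a M' ρ' (K - n)) j) b.1 b.2) (fun b => A' b.1 b.2)
          ≤ B₀ * (bondNorm (F.P K).L (K - n) (((F.L : ℝ)⁻¹) ^ (K - n)) (-(3 : ℝ)) (cubeFam false (F.P K).L a M' ρ' (K - n)) (fun x μ => Jcur (((F.L : ℝ)⁻¹) ^ (K - n)) (1 : LSite (F.P K).d → Fin (F.P K).d → (Matrix (Fin 2) (Fin 2) ℂ)ˣ) A' μ x)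
            + wsup 1 (fun p : {p : ℕ × (LSite (F.P K).d × Fin (F.P K).d) // p.1 ≤ K - n ∧ (p.2 ∈ (cubeLamBP' (F.P K).L a M' ρ' (K - n) (K - n)) p.1 ∨ (p.1 = 0 ∧ CrossB ((cubeFam false (F.P K).L a M' ρ' (K - n)) 0) p.2))} => linCovIter (F.P K).L (1 : LSite (F.P K).d → Fin (F.P K).d → (Matrix (Fin 2) (Fin 2) ℂ)ˣ) (iEta (((F.L : ℝ)⁻¹) ^ (K - n)) A') p.1.1 p.1.2.1 p.1.2.2))
            + Bbd * msup (F.P K).L (K - n) (((F.L : ℝ)⁻¹) ^ (K - n)) (-(1 : ℝ)) (fun j (b : LSite (F.P K).d × Fin (F.P K).d) => j = 0 ∧ SideTouches ((cubeFam false (F.P K).L a M' ρ' (K - n)) 0) b.1 b.2 ∧ ¬ BondTouches ((cubeFam false (F.P K).L a M' ρ' (K - n)) 0) b.1 b.2) (fun b => A' b.1 b.2) ∧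
        msup (F.P K).L (K - n) (((F.L : ℝ)⁻¹) ^ (K - n)) (-(2 : ℝ)) (fun j (t : Fin (F.P K).d × Fin (F.P K).d × LSite (F.P K).d) => SideTouches ((cubeFam false (F.P K).L a M' ρ' (K - n)) j) t.2.2 t.2.1) (fun t => covDerivFwd (((F.L : ℝ)⁻¹) ^ (K - n)) (1 : LSite (F.P K).d → Fin (F.P K).d → (Matrix (Fin 2) (Fin 2) ℂ)ˣ) t.1 (fun z => A' z t.2.1) t.2.2)
          ≤ B₀ * (bondNorm (F.P K).L (K - n) (((F.L : ℝ)⁻¹) ^ (K - n)) (-(3 : ℝ)) (cubeFam false (F.P K).L a M' ρ' (K - n)) (fun x μ => Jcur (((F.L : ℝ)⁻¹) ^ (K - n)) (1 : LSite (F.P K).d → Fin (F.P K).d → (Matrix (Fin 2) (Fin 2) ℂ)ˣ) A' μ x)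
            + wsup 1 (fun p : {p : ℕ × (LSite (F.P K).d × Fin (F.P K).d) // p.1 ≤ K - n ∧ (p.2 ∈ (cubeLamBP' (F.P K).L a M' ρ' (K - n) (K - n)) p.1 ∨ (p.1 = 0 ∧ CrossB ((cubeFam false (F.P K).L a M' ρ' (K - n)) 0) p.2))} => linCovIter (F.P K).L (1 : LSite (F.P K).d → Fin (F.P K).d → (Matrix (Fin 2) (Fin 2) ℂ)ˣ) (iEta (((F.L : ℝ)⁻¹) ^ (K - n)) A') p.1.1 p.1.2.1 p.1.2.2))
            + Bbd * msup (F.P K).L (K - n) (((F.L : ℝ)⁻¹) ^ (K - n)) (-(1 : ℝ)) (fun j (b : LSite (F.P K).d × Fin (F.P K).d) => j = 0 ∧ SideTouches ((cubeFam false (F.P K).L a M' ρ' (K - n)) 0) b.1 b.2 ∧ ¬ BondTouches ((cubeFam false (F.P K).L a M' ρ' (K - n)) 0) b.1 b.2) (fun b => A' b.1 b.2) := by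
  classical
  obtain ⟨Bs, ρ₀, M₀, N₀, R₀, hBs, H⟩ := H59γ_flat_member L hL
  -- per-`L` sub-lattice letters from the lit thresholds: `sx := ⌈M₀⌉₊`, `ρ₅ := max ⌈ρ₀⌉₊ (max (R₀·L^(sx+1)) (N₀+1))`
  have hL2 : 2 ≤ L := hL
  refine ⟨Bs, ⌈M₀⌉₊, max ⌈ρ₀⌉₊ (max (R₀ * L ^ (⌈M₀⌉₊ + 1)) (N₀ + 1)), hBs, ?_⟩
  intro F hF n K hnK a M' RHO' hρL hdiv hdM hρ₅ B₀ Bbd c hB hBbd hc0 hc V' A' hLan h41 h0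
  -- the seven guards of the sub-lattice from the three antecedents
  have hpowpos : 0 < L ^ (⌈M₀⌉₊ + 1) := Nat.pos_of_ne_zero (pow_ne_zero _ (by omega))
  have hM₀' : M₀ ≤ (L : ℝ) ^ (⌈M₀⌉₊ + 1) := by
    have h1 : M₀ ≤ (⌈M₀⌉₊ : ℝ) := Nat.le_ceil _
    have h2 : ⌈M₀⌉₊ + 1 ≤ L ^ (⌈M₀⌉₊ + 1) := (Nat.lt_pow_self (by omega)).le
    have h3 : ((⌈M₀⌉₊ : ℕ) : ℝ) + 1 ≤ ((L ^ (⌈M₀⌉₊ + 1) : ℕ) : ℝ) := by exact_mod_cast h2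
    push_cast at h3
    linarith
  have hρ₅' : max ⌈ρ₀⌉₊ (max (R₀ * L ^ (⌈M₀⌉₊ + 1)) (N₀ + 1)) ≤ RHO' := hρ₅
  have hRx : RHO' / L ^ (⌈M₀⌉₊ + 1) * L ^ (⌈M₀⌉₊ + 1) = RHO' := Nat.div_mul_cancel hdiv
  have hRρ : RHO' / L ^ (⌈M₀⌉₊ + 1) * L ^ (⌈M₀⌉₊ + 1) ≤ RHO' := hRx.le
  have hR₀ : R₀ ≤ RHO' / L ^ (⌈M₀⌉₊ + 1) := by
    have h1 : R₀ * L ^ (⌈M₀⌉₊ + 1) ≤ RHO' / L ^ (⌈M₀⌉₊ + 1) * L ^ (⌈M₀⌉₊ + 1) := by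
      rw [hRx]; exact ((le_max_left _ _).trans (le_max_right _ _)).trans hρ₅'
    exact Nat.le_of_mul_le_mul_right h1 hpowpos
  have hN₀ : N₀ + 1 ≤ RHO' / L ^ (⌈M₀⌉₊ + 1) * L ^ (⌈M₀⌉₊ + 1) := by
    rw [hRx]; exact ((le_max_right _ _).trans (le_max_right _ _)).trans hρ₅'
  have hρ₀ : ρ₀ ≤ ((RHO' : ℕ) : ℝ) := by
    have h1 : ρ₀ ≤ (⌈ρ₀⌉₊ : ℝ) := Nat.le_ceil _
    have h2 : ((⌈ρ₀⌉₊ : ℕ) : ℝ) ≤ ((RHO' : ℕ) : ℝ) := by exact_mod_cast (le_max_left _ _).trans hρ₅'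
    linarith
  exact H F hF n K hnK a M' RHO' (⌈M₀⌉₊) (RHO' / L ^ (⌈M₀⌉₊ + 1)) hρL hM₀' hdiv hdM hRρ hR₀ hN₀ hρ₀ B₀ Bbd c hB hBbd hc0 hc V' A' hLan h41 h0

/-! ## §2 The K-final pack's `H59TLγ` conjunct, «ρ5» letters -/

/-- ★★ **«(γ-6) ρ5», PACK SHAPE, TOP**: ✓p685244's displayed `H59TLγ` conjunct with the ONE line «`L ^ (sx + 1) ∣ ρ + M + L + S → L ^ (sx + 1) ∣ M′ → ρ₅ ≤ ρ →`» after
`ρ′ = ρ + M + L + S →`, for all socket letters `B₀, Bbd ≥ Bs`. [cite: Balaban1985RegularSpaces, (1.58)-(1.59) p.86, p.98, Prop. 3 p.87; Balaban1985BackgroundPropagators, Thm 3.3 p.399] -/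
theorem H59TLγ5_holds_member (L : ℕ) (hL : 1 < L) :
    ∃ Bs : ℝ, ∃ sx ρ₅ : ℕ, 1 ≤ Bs ∧
    ∀ (M' : ℕ) (B₀ B₀'H B₂' BG BR cB9 Bbd : ℝ), Bs ≤ B₀ → Bs ≤ Bbd → 0 < B₀'H → 0 ≤ B₂' → 0 ≤ BG → 0 ≤ BR → 0 < cB9 →
    (∀ (F : T3Family), F.L = L → ∀ (n K : ℕ) (hnK : n < K) (ρ S M ρ' : ℕ), ρ' = ρ + M + L + S →
      -- «ρ5»: the cube datum on print's p. 98 sub-lattice, three antecedents (`sx ρ₅` opened once per `L`)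
      L ^ (sx + 1) ∣ ρ + M + L + S → L ^ (sx + 1) ∣ M' → ρ₅ ≤ ρ →
      1 ≤ M → 2 ≤ S → ∀ (a₅ Cr ε₀ ε₁ : ℝ), 0 < Cr → 4 < Cr → 12 * ((ρ : ℝ) + (M : ℝ)) * a₅ ≤ Cr → 0 < ε₁ → 0 < ε₀ → ε₀ ≤ a₅ → Cr * ε₁ ≤ ε₀ →
      (10 : ℝ) ^ 29 * (L : ℝ) ^ 12 * (1 + B₀ + B₀⁻¹) ^ 2 * ((1 + B₀'H) * (1 + B₂') * (1 + BG) * (1 + BR)) ^ 5 * (1 + cB9⁻¹) * ((((ρ + M + L + S : ℕ) : ℝ) + (M' : ℝ) + 1) ^ 3 * ε₀) ≤ 1 →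
      2 * ρ + (M' + 1 + 2 * (M + L + S)) ≤ F.L ^ (F.m + n) → ∀ (V : GaugeField (F.P n) 0 (Matrix.specialUnitaryGroup (Fin 2) ℂ)), PlaqSmall ε₁ V → ∀ U ∈ regFibrePr F n K hnK.le ε₀ V,
      ∀ (x₀ : Site (F.P K) 0) (t : ℤ), 0 ≤ t → t ≤ (M' : ℤ) - 1 → ∀ (a : LSite (F.P K).d), a = (fun μ => ((iterBlockOf (K - n) x₀ μ).val : ℤ) - t) →
      ∀ (α₁ α₄ cstar : ℝ), α₁ = 198 * (((ρ' : ℝ) + M' + 1) * ε₀) + 27 * (((ρ' : ℝ) + M' + 1) * ε₀) / ((L : ℝ) * B₀) → cstar = 5 * (F.P K).d * (F.P K).L * B₀ * (ε₀ + α₁) →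
      α₄ = 8 * (300 * (L : ℝ) * ((3 * (M' + ρ') + 1 : ℕ) : ℝ) * (B₀'H + 15 * (L : ℝ) ^ 2 * BG * BR + 3 * BG * BR * B₂')) * (5 * ((3 : ℕ) : ℝ) * L * B₀) * (ε₀ + α₁) → ∀ (s : ℝ), s = (198 + 12 * (((M' : ℝ) - 1) + 4 * ρ')) * ε₀ →
      ∀ (gJ : GaugeTransf (F.P K) 0 (Matrix.specialUnitaryGroup (Fin 2) ℂ)),
      InAk (F.P K).L (K - n) (((F.L : ℝ)⁻¹) ^ (K - n)) ε₀ (fun _ => (Set.univ : Set (LSite (F.P K).d))) (pull (unitsField (toUField (GaugeField.gaugeAct gJ U))) 0) →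
      (∀ m', m' ≤ K - n → ∀ Λ : ℕ → Set (LSite (F.P K).d), InAx (F.P K).L m' Λ (1 : LSite (F.P K).d → Fin (F.P K).d → (Matrix (Fin 2) (Fin 2) ℂ)ˣ) (pull (unitsField (toUField (GaugeField.gaugeAct gJ U))) 0)) →
      (∀ m', m' ≤ K - n → ∀ (x : LSite (F.P K).d) (ν : Fin (F.P K).d), tlo (F.P K).L (tLo a ρ') m' ≤ x → x + e ν ≤ thi (F.P K).L (tHi a M' ρ') m' →
      ‖((avgIter (F.P K).L (pull (unitsField (toUField (GaugeField.gaugeAct gJ U))) 0) (K - n - m') x ν : (Matrix (Fin 2) (Fin 2) ℂ)ˣ) :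
      Matrix (Fin 2) (Fin 2) ℂ) - 1‖ < s) →
      ∀ (g' : GaugeTransf (F.P K) 0 (Matrix (Fin 2) (Fin 2) ℂ)ˣ) (u : LSite (F.P K).d → (Matrix (Fin 2) (Fin 2) ℂ)ˣ) (V' : LSite (F.P K).d → Fin (F.P K).d → (Matrix (Fin 2) (Fin 2) ℂ)ˣ)
      (A' : LSite (F.P K).d → Fin (F.P K).d → (Matrix (Fin 2) (Fin 2) ℂ)),
      (∀ x, u x ∈ unitaryUnits (Matrix (Fin 2) (Fin 2) ℂ)) → (∀ x, x ∉ (cubeFam false (F.P K).L a M' ρ' (K - n)) 0 → u x = 1) →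
      mgauge (1 : LSite (F.P K).d → Fin (F.P K).d → (Matrix (Fin 2) (Fin 2) ℂ)ˣ) u V' = (pull (unitsField (toUField (GaugeField.gaugeAct gJ U))) 0) →
      Restr129 (F.P K).L (K - n) (Function.update (cubeLamS (F.P K).L a M' ρ' (K - n) (K - n)) (K - n) ∅) (1 : LSite (F.P K).d → Fin (F.P K).d → (Matrix (Fin 2) (Fin 2) ℂ)ˣ) u →
      (IsLandau138W (F.P K).L (K - n) (((F.L : ℝ)⁻¹) ^ (K - n)) ((cubeFam false (F.P K).L a M' ρ' (K - n)) 0) (cubeLamS (F.P K).L a M' ρ' (K - n) (K - n)) (1 : LSite (F.P K).d → Fin (F.P K).d → (Matrix (Fin 2) (Fin 2) ℂ)ˣ) V' ∧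
      (∀ c ∈ (cubeLamBP' (F.P K).L a M' ρ' (K - n) (K - n)) (K - n), ∀ (y : LSite (F.P K).d) (τ : Fin (F.P K).d),
      InBox (loK (F.P K).L (K - n) c.1) (bondHiK (F.P K).L (K - n) c.1 c.2) y → InBox (loK (F.P K).L (K - n) c.1) (bondHiK (F.P K).L (K - n) c.1 c.2) (y + e τ) →
      V' y τ = gaugeActT g' (unitsField (toUField U)) ⟨cover (F.P K) y, τ⟩)) →
      (∀ y τ, IsSelfAdjoint (A' y τ)) →
      (∀ j, j ≤ K - n → ∀ y τ, SideTouches ((cubeFam false (F.P K).L a M' ρ' (K - n)) j) y τ →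
      V' y τ = cfgExp (((F.L : ℝ)⁻¹) ^ (K - n)) A' y τ ∧ ‖A' y τ‖ ≤ (2 * ((F.P K).L * cstar) + 8 * α₄) * (((F.P K).L : ℝ) ^ j * (((F.L : ℝ)⁻¹) ^ (K - n)))⁻¹) →
      (∀ y τ, (∀ j, j ≤ K - n → ¬ SideTouches ((cubeFam false (F.P K).L a M' ρ' (K - n)) j) y τ) → A' y τ = 0) →
      msup (F.P K).L (K - n) (((F.L : ℝ)⁻¹) ^ (K - n)) (-(1 : ℝ)) (fun j (b : LSite (F.P K).d × Fin (F.P K).d) => SideTouches ((cubeFam false (F.P K).L a M' ρ' (K - n)) j) b.1 b.2) (fun b => A' b.1 b.2)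
      ≤ B₀ * (bondNorm (F.P K).L (K - n) (((F.L : ℝ)⁻¹) ^ (K - n)) (-(3 : ℝ)) (cubeFam false (F.P K).L a M' ρ' (K - n)) (fun x μ => Jcur (((F.L : ℝ)⁻¹) ^ (K - n)) (1 : LSite (F.P K).d → Fin (F.P K).d → (Matrix (Fin 2) (Fin 2) ℂ)ˣ) A' μ x)
      + wsup 1 (fun p : {p : ℕ × (LSite (F.P K).d × Fin (F.P K).d) // p.1 ≤ K - n ∧ (p.2 ∈ (cubeLamBP' (F.P K).L a M' ρ' (K - n) (K - n)) p.1 ∨ (p.1 = 0 ∧ CrossB ((cubeFam false (F.P K).L a M' ρ' (K - n)) 0) p.2))} =>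
      linCovIter (F.P K).L (1 : LSite (F.P K).d → Fin (F.P K).d → (Matrix (Fin 2) (Fin 2) ℂ)ˣ) (iEta (((F.L : ℝ)⁻¹) ^ (K - n)) A') p.1.1 p.1.2.1 p.1.2.2))
      + Bbd * msup (F.P K).L (K - n) (((F.L : ℝ)⁻¹) ^ (K - n)) (-(1 : ℝ)) (fun j (b : LSite (F.P K).d × Fin (F.P K).d) => j = 0 ∧ SideTouches ((cubeFam false (F.P K).L a M' ρ' (K - n)) 0) b.1 b.2 ∧ ¬ BondTouches ((cubeFam false (F.P K).L a M' ρ' (K - n)) 0) b.1 b.2) (fun b => A' b.1 b.2) ∧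
      msup (F.P K).L (K - n) (((F.L : ℝ)⁻¹) ^ (K - n)) (-(2 : ℝ)) (fun j (t : Fin (F.P K).d × Fin (F.P K).d × LSite (F.P K).d) => SideTouches ((cubeFam false (F.P K).L a M' ρ' (K - n)) j) t.2.2 t.2.1)
      (fun t => covDerivFwd (((F.L : ℝ)⁻¹) ^ (K - n)) (1 : LSite (F.P K).d → Fin (F.P K).d → (Matrix (Fin 2) (Fin 2) ℂ)ˣ) t.1 (fun z => A' z t.2.1) t.2.2)
      ≤ B₀ * (bondNorm (F.P K).L (K - n) (((F.L : ℝ)⁻¹) ^ (K - n)) (-(3 : ℝ)) (cubeFam false (F.P K).L a M' ρ' (K - n)) (fun x μ => Jcur (((F.L : ℝ)⁻¹) ^ (K - n)) (1 : LSite (F.P K).d → Fin (F.P K).d → (Matrix (Fin 2) (Fin 2) ℂ)ˣ) A' μ x)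
      + wsup 1 (fun p : {p : ℕ × (LSite (F.P K).d × Fin (F.P K).d) // p.1 ≤ K - n ∧ (p.2 ∈ (cubeLamBP' (F.P K).L a M' ρ' (K - n) (K - n)) p.1 ∨ (p.1 = 0 ∧ CrossB ((cubeFam false (F.P K).L a M' ρ' (K - n)) 0) p.2))} =>
      linCovIter (F.P K).L (1 : LSite (F.P K).d → Fin (F.P K).d → (Matrix (Fin 2) (Fin 2) ℂ)ˣ) (iEta (((F.L : ℝ)⁻¹) ^ (K - n)) A') p.1.1 p.1.2.1 p.1.2.2))
      + Bbd * msup (F.P K).L (K - n) (((F.L : ℝ)⁻¹) ^ (K - n)) (-(1 : ℝ)) (fun j (b : LSite (F.P K).d × Fin (F.P K).d) => j = 0 ∧ SideTouches ((cubeFam false (F.P K).L a M' ρ' (K - n)) 0) b.1 b.2 ∧ ¬ BondTouches ((cubeFam false (F.P K).L a M' ρ' (K - n)) 0) b.1 b.2) (fun b => A' b.1 b.2)) := by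
  classical
  obtain ⟨Bs, ρ₀, M₀, N₀, R₀, hBs, H⟩ := H59TLγP_holds_member L hL
  -- per-`L` sub-lattice letters from the lit thresholds: `sx := ⌈M₀⌉₊`, `ρ₅ := max ⌈ρ₀⌉₊ (max (R₀·L^(sx+1)) (N₀+1))`
  have hL2 : 2 ≤ L := hL
  refine ⟨Bs, ⌈M₀⌉₊, max ⌈ρ₀⌉₊ (max (R₀ * L ^ (⌈M₀⌉₊ + 1)) (N₀ + 1)), hBs, ?_⟩
  intro M' B₀ B₀'H B₂' BG BR cB9 Bbd hB hBbd hB₀'H hB₂' hBG hBR hcB9 F hF n K hnK ρ S M ρ' hρ'def hdiv hdM hρ₅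
  have RHO'def : ρ + M + L + S = ρ' := hρ'def.symm
  set RHO' : ℕ := ρ + M + L + S with hRHO'
  -- the seven guards of the sub-lattice from the three antecedents
  have hpowpos : 0 < L ^ (⌈M₀⌉₊ + 1) := Nat.pos_of_ne_zero (pow_ne_zero _ (by omega))
  have hM₀' : M₀ ≤ (L : ℝ) ^ (⌈M₀⌉₊ + 1) := by
    have h1 : M₀ ≤ (⌈M₀⌉₊ : ℝ) := Nat.le_ceil _
    have h2 : ⌈M₀⌉₊ + 1 ≤ L ^ (⌈M₀⌉₊ + 1) := (Nat.lt_pow_self (by omega)).le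
    have h3 : ((⌈M₀⌉₊ : ℕ) : ℝ) + 1 ≤ ((L ^ (⌈M₀⌉₊ + 1) : ℕ) : ℝ) := by exact_mod_cast h2
    push_cast at h3
    linarith
  have hρ'ge : ρ ≤ RHO' := by omega
  have hρ₅' : max ⌈ρ₀⌉₊ (max (R₀ * L ^ (⌈M₀⌉₊ + 1)) (N₀ + 1)) ≤ RHO' := hρ₅.trans hρ'ge
  have hRx : RHO' / L ^ (⌈M₀⌉₊ + 1) * L ^ (⌈M₀⌉₊ + 1) = RHO' := Nat.div_mul_cancel hdiv
  have hRρ : RHO' / L ^ (⌈M₀⌉₊ + 1) * L ^ (⌈M₀⌉₊ + 1) ≤ RHO' := hRx.le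
  have hR₀ : R₀ ≤ RHO' / L ^ (⌈M₀⌉₊ + 1) := by
    have h1 : R₀ * L ^ (⌈M₀⌉₊ + 1) ≤ RHO' / L ^ (⌈M₀⌉₊ + 1) * L ^ (⌈M₀⌉₊ + 1) := by
      rw [hRx]; exact ((le_max_left _ _).trans (le_max_right _ _)).trans hρ₅'
    exact Nat.le_of_mul_le_mul_right h1 hpowpos
  have hN₀ : N₀ + 1 ≤ RHO' / L ^ (⌈M₀⌉₊ + 1) * L ^ (⌈M₀⌉₊ + 1) := by
    rw [hRx]; exact ((le_max_right _ _).trans (le_max_right _ _)).trans hρ₅'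
  have hρ₀ : ρ₀ ≤ ((RHO' : ℕ) : ℝ) := by
    have h1 : ρ₀ ≤ (⌈ρ₀⌉₊ : ℝ) := Nat.le_ceil _
    have h2 : ((⌈ρ₀⌉₊ : ℕ) : ℝ) ≤ ((RHO' : ℕ) : ℝ) := by exact_mod_cast (le_max_left _ _).trans hρ₅'
    linarith
  exact H M' B₀ B₀'H B₂' BG BR cB9 Bbd hB hBbd hB₀'H hB₂' hBG hBR hcB9 F hF n K hnK ρ S M ρ' hρ'def (⌈M₀⌉₊) (RHO' / L ^ (⌈M₀⌉₊ + 1))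
    hM₀' (RHO'def ▸ hdiv) hdM (RHO'def ▸ hRρ) hR₀ (RHO'def ▸ hN₀) (RHO'def ▸ hρ₀)

/-! ## §3 The K-final step pack's `H59DγL` conjunct, «ρ5» letters -/

/-- ★★ **«(γ-6) ρ5», PACK SHAPE, PER DATUM**: ✓p685747's displayed `H59DγL` conjunct with the ONE line «`2 ≤ K − n → L ^ (sx + 1) ∣ ρ + M + L + S → L ^ (sx + 1) ∣ M′ →
ρ₅ ≤ ρ →`» after `ρ′ = ρ + M + L + S →`, for all socket letters `B₀, Bbd ≥ Bs`. [cite: Balaban1985RegularSpaces, (1.58)-(1.59) p.86, p.98, Thm 4 p.88; Balaban1985BackgroundPropagators, Thm 3.3 p.399] -/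
theorem H59DγL5_holds_member (L : ℕ) (hL : 1 < L) :
    ∃ Bs : ℝ, ∃ sx ρ₅ : ℕ, 1 ≤ Bs ∧
    ∀ (M' : ℕ) (B₀ B₀'H B₂' BG BR cB9 Bbd : ℝ), Bs ≤ B₀ → Bs ≤ Bbd → 0 < B₀'H → 0 ≤ B₂' → 0 ≤ BG → 0 ≤ BR → 0 < cB9 →
    (∀ (F : T3Family), F.L = L → ∀ (n K : ℕ) (hnK : n < K) (ρ S M ρ' : ℕ), ρ' = ρ + M + L + S →
      -- «ρ5» + the step guard: three antecedents (`sx ρ₅` opened once per `L`) after `2 ≤ K − n`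
      2 ≤ K - n → L ^ (sx + 1) ∣ ρ + M + L + S → L ^ (sx + 1) ∣ M' → ρ₅ ≤ ρ →
      1 ≤ M → 2 ≤ S → ∀ (a₅ Cr ε₀ ε₁ : ℝ), 0 < Cr → 4 < Cr → 12 * ((ρ : ℝ) + (M : ℝ)) * a₅ ≤ Cr → 0 < ε₁ → 0 < ε₀ → ε₀ ≤ a₅ → Cr * ε₁ ≤ ε₀ →
      (10 : ℝ) ^ 29 * (L : ℝ) ^ 12 * (1 + B₀ + B₀⁻¹) ^ 2 * ((1 + B₀'H) * (1 + B₂') * (1 + BG) * (1 + BR)) ^ 5 * (1 + cB9⁻¹) * ((((ρ + M + L + S : ℕ) : ℝ) + (M' : ℝ) + 1) ^ 3 * ε₀) ≤ 1 →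
      2 * ρ + (M' + 1 + 2 * (M + L + S)) ≤ F.L ^ (F.m + n) → ∀ (V : GaugeField (F.P n) 0 (Matrix.specialUnitaryGroup (Fin 2) ℂ)), PlaqSmall ε₁ V → ∀ U ∈ regFibrePr F n K hnK.le ε₀ V,
      ∀ (x₀ : Site (F.P K) 0) (t : ℤ), 0 ≤ t → t ≤ (M' : ℤ) - 1 → ∀ (a : LSite (F.P K).d), a = (fun μ => ((iterBlockOf (K - n) x₀ μ).val : ℤ) - t) →
      ∀ (α₁ α₄ cstar : ℝ), α₁ = 198 * (((ρ' : ℝ) + M' + 1) * ε₀) + 27 * (((ρ' : ℝ) + M' + 1) * ε₀) / ((L : ℝ) * B₀) → cstar = 5 * (F.P K).d * (F.P K).L * B₀ * (ε₀ + α₁) →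
      α₄ = 8 * (300 * (L : ℝ) * ((3 * (M' + ρ') + 1 : ℕ) : ℝ) * (B₀'H + 15 * (L : ℝ) ^ 2 * BG * BR + 3 * BG * BR * B₂')) * (5 * ((3 : ℕ) : ℝ) * L * B₀) * (ε₀ + α₁) → ∀ (s : ℝ), s = (198 + 12 * (((M' : ℝ) - 1) + 4 * ρ')) * ε₀ →
      ∀ (W : LSite (F.P K).d → Fin (F.P K).d → (Matrix (Fin 2) (Fin 2) ℂ)ˣ) (A' : LSite (F.P K).d → Fin (F.P K).d → (Matrix (Fin 2) (Fin 2) ℂ)),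
      (∀ x κ, W x κ ∈ unitaryUnits (Matrix (Fin 2) (Fin 2) ℂ)) → InAk (F.P K).L (K - n - 1) (((F.L : ℝ)⁻¹) ^ (K - n)) ε₀ (cubeFam false (F.P K).L a M' ρ' (K - n)) W →
      IsLandau138W (F.P K).L (K - n - 1) (((F.L : ℝ)⁻¹) ^ (K - n)) ((cubeFam false (F.P K).L a M' ρ' (K - n)) 0) (cubeLamS (F.P K).L a M' ρ' (K - n) (K - n - 1)) (1 : LSite (F.P K).d → Fin (F.P K).d → (Matrix (Fin 2) (Fin 2) ℂ)ˣ) W →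
      (∀ y τ, IsSelfAdjoint (A' y τ)) → (∀ j, j ≤ K - n - 1 → ∀ (y : LSite (F.P K).d) (τ : Fin (F.P K).d), SideTouches ((cubeFam false (F.P K).L a M' ρ' (K - n)) j) y τ → W y τ = cfgExp (((F.L : ℝ)⁻¹) ^ (K - n)) A' y τ ∧ ‖A' y τ‖ ≤ cstar * (((F.P K).L : ℝ) ^ j * (((F.L : ℝ)⁻¹) ^ (K - n)))⁻¹) →
      (∀ (y : LSite (F.P K).d) (τ : Fin (F.P K).d), (∀ j, j ≤ K - n - 1 → ¬ SideTouches ((cubeFam false (F.P K).L a M' ρ' (K - n)) j) y τ) → A' y τ = 0) →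
      msup (F.P K).L (K - n - 1) (((F.L : ℝ)⁻¹) ^ (K - n)) (-(1 : ℝ)) (fun j (b : LSite (F.P K).d × Fin (F.P K).d) => SideTouches ((cubeFam false (F.P K).L a M' ρ' (K - n)) j) b.1 b.2) (fun b => A' b.1 b.2)
          ≤ B₀ * (bondNorm (F.P K).L (K - n - 1) (((F.L : ℝ)⁻¹) ^ (K - n)) (-(3 : ℝ)) (cubeFam false (F.P K).L a M' ρ' (K - n)) (fun x μ => Jcur (((F.L : ℝ)⁻¹) ^ (K - n)) (1 : LSite (F.P K).d → Fin (F.P K).d → (Matrix (Fin 2) (Fin 2) ℂ)ˣ) A' μ x)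
            + wsup 1 (fun p : {p : ℕ × (LSite (F.P K).d × Fin (F.P K).d) // p.1 ≤ K - n - 1 ∧ (p.2 ∈ (cubeLamBP' (F.P K).L a M' ρ' (K - n) (K - n - 1)) p.1 ∨ (p.1 = 0 ∧ CrossB ((cubeFam false (F.P K).L a M' ρ' (K - n)) 0) p.2))} => linCovIter (F.P K).L (1 : LSite (F.P K).d → Fin (F.P K).d → (Matrix (Fin 2) (Fin 2) ℂ)ˣ) (iEta (((F.L : ℝ)⁻¹) ^ (K - n)) A') p.1.1 p.1.2.1 p.1.2.2))
            + Bbd * msup (F.P K).L (K - n - 1) (((F.L : ℝ)⁻¹) ^ (K - n)) (-(1 : ℝ)) (fun j (b : LSite (F.P K).d × Fin (F.P K).d) => j = 0 ∧ SideTouches ((cubeFam false (F.P K).L a M' ρ' (K - n)) 0) b.1 b.2 ∧ ¬ BondTouches ((cubeFam false (F.P K).L a M' ρ' (K - n)) 0) b.1 b.2) (fun b => A' b.1 b.2) ∧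
        msup (F.P K).L (K - n - 1) (((F.L : ℝ)⁻¹) ^ (K - n)) (-(2 : ℝ)) (fun j (t : Fin (F.P K).d × Fin (F.P K).d × LSite (F.P K).d) => SideTouches ((cubeFam false (F.P K).L a M' ρ' (K - n)) j) t.2.2 t.2.1) (fun t => covDerivFwd (((F.L : ℝ)⁻¹) ^ (K - n)) (1 : LSite (F.P K).d → Fin (F.P K).d → (Matrix (Fin 2) (Fin 2) ℂ)ˣ) t.1 (fun z => A' z t.2.1) t.2.2)
          ≤ B₀ * (bondNorm (F.P K).L (K - n - 1) (((F.L : ℝ)⁻¹) ^ (K - n)) (-(3 : ℝ)) (cubeFam false (F.P K).L a M' ρ' (K - n)) (fun x μ => Jcur (((F.L : ℝ)⁻¹) ^ (K - n)) (1 : LSite (F.P K).d → Fin (F.P K).d → (Matrix (Fin 2) (Fin 2) ℂ)ˣ) A' μ x)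
            + wsup 1 (fun p : {p : ℕ × (LSite (F.P K).d × Fin (F.P K).d) // p.1 ≤ K - n - 1 ∧ (p.2 ∈ (cubeLamBP' (F.P K).L a M' ρ' (K - n) (K - n - 1)) p.1 ∨ (p.1 = 0 ∧ CrossB ((cubeFam false (F.P K).L a M' ρ' (K - n)) 0) p.2))} => linCovIter (F.P K).L (1 : LSite (F.P K).d → Fin (F.P K).d → (Matrix (Fin 2) (Fin 2) ℂ)ˣ) (iEta (((F.L : ℝ)⁻¹) ^ (K - n)) A') p.1.1 p.1.2.1 p.1.2.2))
            + Bbd * msup (F.P K).L (K - n - 1) (((F.L : ℝ)⁻¹) ^ (K - n)) (-(1 : ℝ)) (fun j (b : LSite (F.P K).d × Fin (F.P K).d) => j = 0 ∧ SideTouches ((cubeFam false (F.P K).L a M' ρ' (K - n)) 0) b.1 b.2 ∧ ¬ BondTouches ((cubeFam false (F.P K).L a M' ρ' (K - n)) 0) b.1 b.2) (fun b => A' b.1 b.2)) := by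
  classical
  obtain ⟨Bs, ρ₀, M₀, N₀, R₀, hBs, H⟩ := H59DγLP_holds_member L hL
  -- per-`L` sub-lattice letters from the lit thresholds: `sx := ⌈M₀⌉₊`, `ρ₅ := max ⌈ρ₀⌉₊ (max (R₀·L^(sx+1)) (N₀+1))`
  have hL2 : 2 ≤ L := hL
  refine ⟨Bs, ⌈M₀⌉₊, max ⌈ρ₀⌉₊ (max (R₀ * L ^ (⌈M₀⌉₊ + 1)) (N₀ + 1)), hBs, ?_⟩
  intro M' B₀ B₀'H B₂' BG BR cB9 Bbd hB hBbd hB₀'H hB₂' hBG hBR hcB9 F hF n K hnK ρ S M ρ' hρ'def h2 hdiv hdM hρ₅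
  have RHO'def : ρ + M + L + S = ρ' := hρ'def.symm
  set RHO' : ℕ := ρ + M + L + S with hRHO'
  -- the seven guards of the sub-lattice from the three antecedents
  have hpowpos : 0 < L ^ (⌈M₀⌉₊ + 1) := Nat.pos_of_ne_zero (pow_ne_zero _ (by omega))
  have hM₀' : M₀ ≤ (L : ℝ) ^ (⌈M₀⌉₊ + 1) := by
    have h1 : M₀ ≤ (⌈M₀⌉₊ : ℝ) := Nat.le_ceil _
    have h2 : ⌈M₀⌉₊ + 1 ≤ L ^ (⌈M₀⌉₊ + 1) := (Nat.lt_pow_self (by omega)).le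
    have h3 : ((⌈M₀⌉₊ : ℕ) : ℝ) + 1 ≤ ((L ^ (⌈M₀⌉₊ + 1) : ℕ) : ℝ) := by exact_mod_cast h2
    push_cast at h3
    linarith
  have hρ'ge : ρ ≤ RHO' := by omega
  have hρ₅' : max ⌈ρ₀⌉₊ (max (R₀ * L ^ (⌈M₀⌉₊ + 1)) (N₀ + 1)) ≤ RHO' := hρ₅.trans hρ'ge
  have hRx : RHO' / L ^ (⌈M₀⌉₊ + 1) * L ^ (⌈M₀⌉₊ + 1) = RHO' := Nat.div_mul_cancel hdiv
  have hRρ : RHO' / L ^ (⌈M₀⌉₊ + 1) * L ^ (⌈M₀⌉₊ + 1) ≤ RHO' := hRx.le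
  have hR₀ : R₀ ≤ RHO' / L ^ (⌈M₀⌉₊ + 1) := by
    have h1 : R₀ * L ^ (⌈M₀⌉₊ + 1) ≤ RHO' / L ^ (⌈M₀⌉₊ + 1) * L ^ (⌈M₀⌉₊ + 1) := by
      rw [hRx]; exact ((le_max_left _ _).trans (le_max_right _ _)).trans hρ₅'
    exact Nat.le_of_mul_le_mul_right h1 hpowpos
  have hN₀ : N₀ + 1 ≤ RHO' / L ^ (⌈M₀⌉₊ + 1) * L ^ (⌈M₀⌉₊ + 1) := by
    rw [hRx]; exact ((le_max_right _ _).trans (le_max_right _ _)).trans hρ₅'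
  have hρ₀ : ρ₀ ≤ ((RHO' : ℕ) : ℝ) := by
    have h1 : ρ₀ ≤ (⌈ρ₀⌉₊ : ℝ) := Nat.le_ceil _
    have h2 : ((⌈ρ₀⌉₊ : ℕ) : ℝ) ≤ ((RHO' : ℕ) : ℝ) := by exact_mod_cast (le_max_left _ _).trans hρ₅'
    linarith
  exact H M' B₀ B₀'H B₂' BG BR cB9 Bbd hB hBbd hB₀'H hB₂' hBG hBR hcB9 F hF n K hnK ρ S M ρ' hρ'def h2 (⌈M₀⌉₊) (RHO' / L ^ (⌈M₀⌉₊ + 1))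
    hM₀' (RHO'def ▸ hdiv) hdM (RHO'def ▸ hRρ) hR₀ (RHO'def ▸ hN₀) (RHO'def ▸ hρ₀)

end Summit.QuantumFields.YangMills.Theorems.HalvingH59GammaDischargeFlatRho5

end
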